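import Mathlib
import Summits.RiemannHypothesis.RiemannHypothesis.Theorems.SoloBlindLatticeBlind

/-!
# Two-sheet lattice formula: an off-line pair lattice is VISIBLE in the Nyquist gap
(solo-blind artefact 8; Theorem D4 of the report, and an erratum to artefact 7's docstring)

Notation as in `SoloBlindLatticeBlind`: for `g ∈ L²(ℝ)` put `H_g(z) = ∫ g(x) e^{izx} dx`, and for the
lattice `u_j = u₀ + j s` (`s > 0`, period `T = 2π/s`) pushed off the line by `δ` consider the zero-side
summands `H_g(u_j - iδ) · conj H_g(u_j + iδ)`.

* `soloBlind_lattice_twoSheet` (Lemma P of the report with two sheets): if `g` is supported in an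
  interval `(c, c + 2T]` then
  `Σ_j H_g(u_j - iδ) conj H_g(u_j + iδ) = T · (‖g‖₂² + e^{δT} e^{iu₀T} κ + e^{-δT} e^{-iu₀T} conj κ)`,
  `κ = ∫ conj g(x) · g(x + T) dx`.  (Artefact 7 is the one-sheet case, where `κ` is absent and the value
  does not depend on `δ`.)  Proof: the two integrals are `T` times Fourier coefficients of the two-sheet
  periodisations of `e^{iu₀x} e^{±δx} g` on the circle `ℝ/Tℤ`; polarised Parseval; the cross terms of
  the two sheets produce `κ` with the weights `e^{±δT} e^{±iu₀T}`.
* The companion file `SoloBlindPairLatticeVisible` evaluates the formula on an explicit two-block step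
  function for `π/a < s ≤ 2π/a` (window `(-a, a]` holding between one and two periods) and gets the
  NEGATIVE value `4 T ℓ (1 - cosh(δT))`, `ℓ = 2a - T`: on such windows the off-line pair lattice is
  detected by the zero-side functional, in contrast with the blindness for `s ≤ π/a` of artefact 7.

ERRATUM to the docstring of `SoloBlindLatticeBlind` (prose only; its theorems are unaffected): the
sentence identifying the threshold `s = π/a` with the height `2π e^{2a}` compared the lattice spacing
`s` — the spacing of the ORDINATES of off-line PAIRS — with the mean spacing of the ZEROS.  A stretch of
zeros of the zeta density at height `T_h` that lie off the line in pairs has pair-ordinate spacing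
`4π / log(T_h/2π)`, so artefact 7 makes the all-off-line crystal invisible at window `a` only from
`log(T_h/2π) ≥ 4a`; the present file shows it is visible for `2a ≤ log(T_h/2π) < 4a`.  The threshold
`2a` of the report is realised instead by mixed configurations (a dense on-line lattice carrying a sparse
sublattice of shallow off-line pairs), see the report, window-height §8.

All statements are about the abstract functional (Fourier analysis on `AddCircle`), not about `ζ`.
-/

open MeasureTheory Complex Set AddCircle
open scoped Real ComplexConjugate

namespace Summit.RiemannHypothesis.RiemannHypothesis.Theorems

/-- The Fourier monomial of the circle of length `T` is `T`-periodic. -/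
theorem soloBlind_fourierMonomial_periodic (T : ℝ) (hT : T ≠ 0) (j : ℤ) (x : ℝ) :
    cexp (2 * π * I * j * ((x + T : ℝ) : ℂ) / (T : ℂ)) = cexp (2 * π * I * j * (x : ℂ) / (T : ℂ)) := by
  have hT' : (T : ℂ) ≠ 0 := by exact_mod_cast hT
  have h : 2 * π * I * j * ((x + T : ℝ) : ℂ) / (T : ℂ) =
      2 * π * I * j * (x : ℂ) / (T : ℂ) + j * (2 * π * I) := by
    push_cast
    field_simp
  rw [h, Complex.exp_add, Complex.exp_int_mul_two_pi_mul_I]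
  simp

/-- The Fourier monomial has norm one. -/
theorem soloBlind_norm_fourierMonomial (T : ℝ) (j : ℤ) (x : ℝ) :
    ‖cexp (2 * π * I * j * (x : ℂ) / (T : ℂ))‖ = 1 := by
  have h : 2 * π * I * j * (x : ℂ) / (T : ℂ) = ((2 * π * j * x / T : ℝ) : ℂ) * I := by
    push_cast
    ring
  rw [h, Complex.norm_exp_ofReal_mul_I]

/-- Weight bookkeeping: `conj (e^{iu₀x} e^{-δx} gx) · (e^{iu₀y} e^{δy} gy) = e^{iu₀(y-x)} e^{δ(y-x)} conj gx · gy`. -/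
theorem soloBlind_conj_weighted_mul (u₀ δ x y : ℝ) (gx gy : ℂ) :
    conj (cexp (((u₀ * x : ℝ) : ℂ) * I) * ((Real.exp (-δ * x) : ℝ) : ℂ) * gx) *
        (cexp (((u₀ * y : ℝ) : ℂ) * I) * ((Real.exp (δ * y) : ℝ) : ℂ) * gy) =
      cexp (((u₀ * (y - x) : ℝ) : ℂ) * I) * ((Real.exp (δ * (y - x)) : ℝ) : ℂ) * (conj gx * gy) := by
  have h1 : conj (cexp (((u₀ * x : ℝ) : ℂ) * I)) * cexp (((u₀ * y : ℝ) : ℂ) * I) =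
      cexp (((u₀ * (y - x) : ℝ) : ℂ) * I) := by
    rw [← Complex.exp_conj, ← Complex.exp_add]
    congr 1
    simp only [map_mul, Complex.conj_ofReal, Complex.conj_I]
    push_cast
    ring
  have h2 : ((Real.exp (-δ * x) : ℝ) : ℂ) * ((Real.exp (δ * y) : ℝ) : ℂ) =
      ((Real.exp (δ * (y - x)) : ℝ) : ℂ) := by
    rw [← Complex.ofReal_mul, ← Real.exp_add]
    congr 2
    ring
  simp only [map_mul, Complex.conj_ofReal]
  rw [← h1, ← h2]
  ring

/-- Same point on both sides: the weights cancel. -/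
theorem soloBlind_conj_weighted_mul_same (u₀ δ x : ℝ) (gx gy : ℂ) :
    conj (cexp (((u₀ * x : ℝ) : ℂ) * I) * ((Real.exp (-δ * x) : ℝ) : ℂ) * gx) *
        (cexp (((u₀ * x : ℝ) : ℂ) * I) * ((Real.exp (δ * x) : ℝ) : ℂ) * gy) = conj gx * gy := by
  rw [soloBlind_conj_weighted_mul]
  simp

/-- Second point one period to the right: weight `e^{δT} e^{iu₀T}`. -/
theorem soloBlind_conj_weighted_mul_shift (u₀ δ x T : ℝ) (gx gy : ℂ) :
    conj (cexp (((u₀ * x : ℝ) : ℂ) * I) * ((Real.exp (-δ * x) : ℝ) : ℂ) * gx) *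
        (cexp (((u₀ * (x + T) : ℝ) : ℂ) * I) * ((Real.exp (δ * (x + T)) : ℝ) : ℂ) * gy) =
      ((Real.exp (δ * T) : ℝ) : ℂ) * cexp (((u₀ * T : ℝ) : ℂ) * I) * (conj gx * gy) := by
  rw [soloBlind_conj_weighted_mul, add_sub_cancel_left]
  ring

/-- First point one period to the right: weight `e^{-δT} e^{-iu₀T}`. -/
theorem soloBlind_conj_weighted_mul_unshift (u₀ δ x T : ℝ) (gx gy : ℂ) :
    conj (cexp (((u₀ * (x + T) : ℝ) : ℂ) * I) * ((Real.exp (-δ * (x + T)) : ℝ) : ℂ) * gx) *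
        (cexp (((u₀ * x : ℝ) : ℂ) * I) * ((Real.exp (δ * x) : ℝ) : ℂ) * gy) =
      ((Real.exp (-(δ * T)) : ℝ) : ℂ) * cexp (-(((u₀ * T : ℝ) : ℂ) * I)) * (conj gx * gy) := by
  rw [soloBlind_conj_weighted_mul, sub_add_cancel_left, mul_neg, mul_neg, Complex.ofReal_neg, neg_mul]
  ring

/-- **Two-sheet lattice formula (Lemma P of the report, K = 2).**  For `g ∈ L²(ℝ)` supported in
`(c, c + 4π/s]` (two periods `T = 2π/s`) and the lattice `u_j = u₀ + j s` pushed off the line by `δ`: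
`Σ_j H_g(u_j - iδ) conj H_g(u_j + iδ) = T (‖g‖₂² + e^{δT} e^{iu₀T} κ + e^{-δT} e^{-iu₀T} conj κ)` with
`κ = ∫ conj g(x) g(x + T) dx`. -/
theorem soloBlind_lattice_twoSheet (c s u₀ δ : ℝ) (hs : 0 < s) {g : ℝ → ℂ}
    (hg : MemLp g 2 volume) (hsupp : Function.support g ⊆ Ioc c (c + 4 * π / s)) :
    HasSum (fun j : ℤ =>
        (∫ x : ℝ, g x * cexp (I * (((u₀ + j * s : ℝ) : ℂ) - I * δ) * x)) *
        conj (∫ x : ℝ, g x * cexp (I * (((u₀ + j * s : ℝ) : ℂ) + I * δ) * x)))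
      (((2 * π / s : ℝ) : ℂ) *
        ((((∫ x : ℝ, ‖g x‖ ^ 2 : ℝ)) : ℂ) +
          ((Real.exp (δ * (2 * π / s)) : ℝ) : ℂ) * cexp (((u₀ * (2 * π / s) : ℝ) : ℂ) * I) *
            (∫ x : ℝ, conj (g x) * g (x + 2 * π / s)) +
          ((Real.exp (-(δ * (2 * π / s))) : ℝ) : ℂ) * cexp (-(((u₀ * (2 * π / s) : ℝ) : ℂ) * I)) *
            conj (∫ x : ℝ, conj (g x) * g (x + 2 * π / s)))) := by
  set T : ℝ := 2 * π / s with hTdef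
  have hT : 0 < T := by rw [hTdef]; positivity
  have hcT : c ≤ c + T := by linarith
  have hc2T : c ≤ c + T + T := by linarith
  have h4 : c + 4 * π / s = c + T + T := by rw [hTdef]; ring
  rw [h4] at hsupp
  -- the weighted copies of `g` and their two-sheet periodisations
  set Gp : ℝ → ℂ := fun x => cexp (((u₀ * x : ℝ) : ℂ) * I) * ((Real.exp (δ * x) : ℝ) : ℂ) * g x
    with hGp_def
  set Gm : ℝ → ℂ := fun x => cexp (((u₀ * x : ℝ) : ℂ) * I) * ((Real.exp (-δ * x) : ℝ) : ℂ) * g x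
    with hGm_def
  set Gp2 : ℝ → ℂ := fun x => Gp x + Gp (x + T) with hGp2_def
  set Gm2 : ℝ → ℂ := fun x => Gm x + Gm (x + T) with hGm2_def
  -- `G_± ∈ L²(ℝ)`
  have hxbound : ∀ x, g x ≠ 0 → |x| ≤ |c| + |c + T + T| := by
    intro x hx
    have hxI : x ∈ Ioc c (c + T + T) := hsupp hx
    rw [abs_le]
    constructor
    · linarith [hxI.1, neg_abs_le c, abs_nonneg (c + T + T)]
    · linarith [hxI.2, le_abs_self (c + T + T), abs_nonneg c]
  have hGbound : ∀ (ε : ℝ), |ε| ≤ |δ| → ∀ x,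
      ‖cexp (((u₀ * x : ℝ) : ℂ) * I) * ((Real.exp (ε * x) : ℝ) : ℂ) * g x‖ ≤
        Real.exp (|δ| * (|c| + |c + T + T|)) * ‖g x‖ := by
    intro ε hε x
    by_cases hx : g x = 0
    · simp [hx]
    · rw [norm_mul]
      apply mul_le_mul_of_nonneg_right _ (norm_nonneg _)
      rw [norm_mul, Complex.norm_exp_ofReal_mul_I, one_mul, Complex.norm_real, Real.norm_eq_abs,
        abs_of_pos (Real.exp_pos _), Real.exp_le_exp]
      calc ε * x ≤ |ε * x| := le_abs_self _
        _ = |ε| * |x| := abs_mul ε x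
        _ ≤ |δ| * (|c| + |c + T + T|) := by
            apply mul_le_mul hε (hxbound x hx) (abs_nonneg _) (abs_nonneg _)
  have hmeas : ∀ ε : ℝ, AEStronglyMeasurable
      (fun x => cexp (((u₀ * x : ℝ) : ℂ) * I) * ((Real.exp (ε * x) : ℝ) : ℂ) * g x) volume := by
    intro ε
    have hc : Continuous fun x : ℝ => cexp (((u₀ * x : ℝ) : ℂ) * I) * ((Real.exp (ε * x) : ℝ) : ℂ) := by
      fun_prop
    exact hc.aestronglyMeasurable.mul hg.aestronglyMeasurable
  have hGp1 : MemLp Gp 2 volume :=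
    hg.of_le_mul (hmeas δ) (Filter.Eventually.of_forall (hGbound δ le_rfl))
  have hGm1 : MemLp Gm 2 volume :=
    hg.of_le_mul (hmeas (-δ)) (Filter.Eventually.of_forall (hGbound (-δ) (by rw [abs_neg])))
  have hGpT : MemLp (fun x => Gp (x + T)) 2 volume :=
    hGp1.comp_measurePreserving (measurePreserving_add_right volume T)
  have hGmT : MemLp (fun x => Gm (x + T)) 2 volume :=
    hGm1.comp_measurePreserving (measurePreserving_add_right volume T)
  have hGp2 : MemLp Gp2 2 (volume.restrict (Ioc c (c + T))) := (hGp1.add hGpT).restrict _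
  have hGm2 : MemLp Gm2 2 (volume.restrict (Ioc c (c + T))) := (hGm1.add hGmT).restrict _
  -- `G_±` are integrable (L² with bounded support)
  have hsuppG : ∀ ε : ℝ, Function.support
      (fun x => cexp (((u₀ * x : ℝ) : ℂ) * I) * ((Real.exp (ε * x) : ℝ) : ℂ) * g x) ⊆
      Ioc c (c + T + T) := fun ε =>
    (Function.support_mul_subset_right _ _).trans hsupp
  have hGp_int : Integrable Gp volume :=
    (integrableOn_iff_integrable_of_support_subset (hsuppG δ)).mp
      (MemLp.integrable one_le_two (hGp1.restrict (Ioc c (c + T + T))))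
  have hGm_int : Integrable Gm volume :=
    (integrableOn_iff_integrable_of_support_subset (hsuppG (-δ))).mp
      (MemLp.integrable one_le_two (hGm1.restrict (Ioc c (c + T + T))))
  have hE : ∀ (j : ℤ) {F : ℝ → ℂ}, Integrable F volume →
      Integrable (fun x : ℝ => cexp (2 * π * I * j * (x : ℂ) / (T : ℂ)) * F x) volume := by
    intro j F hF
    refine hF.bdd_mul (c := 1) ?_ (ae_of_all _ fun x : ℝ => (soloBlind_norm_fourierMonomial T j x).le)
    have hc : Continuous fun x : ℝ => cexp (2 * π * I * j * (x : ℂ) / (T : ℂ)) := by fun_prop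
    exact hc.aestronglyMeasurable
  -- the two integrals as Fourier coefficients of the two-sheet periodisations
  have hcoef : ∀ {G : ℝ → ℂ}, Integrable G volume → (∀ x, g x = 0 → G x = 0) → ∀ j : ℤ,
      (∫ x : ℝ, cexp (2 * π * I * j * (x : ℂ) / (T : ℂ)) * G x) =
        (T : ℂ) * fourierCoeffOn (lt_add_of_pos_right c hT) (fun x => G x + G (x + T)) (-j) := by
    intro G hG hG0 j
    have hGT : Integrable (fun x => G (x + T)) volume := hG.comp_add_right T
    rw [soloBlind_integral_eq_intervalIntegral_of_support hc2T hsupp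
        (F := fun x : ℝ => cexp (2 * π * I * j * (x : ℂ) / (T : ℂ)) * G x)
        (fun x hx => by simp [hG0 x hx]),
      ← intervalIntegral.integral_add_adjacent_intervals (b := c + T)
        (hE j hG).intervalIntegrable (hE j hG).intervalIntegrable]
    have hshift : (∫ x in c..c + T, cexp (2 * π * I * j * ((x + T : ℝ) : ℂ) / (T : ℂ)) * G (x + T)) =
        ∫ x in c + T..c + T + T, cexp (2 * π * I * j * (x : ℂ) / (T : ℂ)) * G x :=
      intervalIntegral.integral_comp_add_right
        (fun x : ℝ => cexp (2 * π * I * j * (x : ℂ) / (T : ℂ)) * G x) T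
    rw [← hshift]
    simp_rw [soloBlind_fourierMonomial_periodic T hT.ne' j]
    rw [← intervalIntegral.integral_add (hE j hG).intervalIntegrable (hE j hGT).intervalIntegrable]
    have hfun : (fun x : ℝ => cexp (2 * π * I * j * (x : ℂ) / (T : ℂ)) * G x +
        cexp (2 * π * I * j * (x : ℂ) / (T : ℂ)) * G (x + T)) =
        fun x : ℝ => cexp (2 * π * I * j * (x : ℂ) / (T : ℂ)) * (G x + G (x + T)) := by
      funext x
      ring
    rw [hfun, soloBlind_intervalIntegral_fourier_mul hT (fun x => G x + G (x + T)) j]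
  have hA : ∀ j : ℤ, (∫ x : ℝ, g x * cexp (I * (((u₀ + j * s : ℝ) : ℂ) - I * δ) * x)) =
      (T : ℂ) * fourierCoeffOn (lt_add_of_pos_right c hT) Gp2 (-j) := by
    intro j
    have hfun : (fun x : ℝ => g x * cexp (I * (((u₀ + j * s : ℝ) : ℂ) - I * δ) * x)) =
        fun x : ℝ => cexp (2 * π * I * j * (x : ℂ) / (T : ℂ)) * Gp x := by
      funext x
      rw [soloBlind_exp_split_minus u₀ s δ x j hs.ne', ← hTdef, hGp_def]
      ring
    rw [hfun, hcoef hGp_int (fun x hx => by simp [hGp_def, hx]) j]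
  have hB : ∀ j : ℤ, (∫ x : ℝ, g x * cexp (I * (((u₀ + j * s : ℝ) : ℂ) + I * δ) * x)) =
      (T : ℂ) * fourierCoeffOn (lt_add_of_pos_right c hT) Gm2 (-j) := by
    intro j
    have hfun : (fun x : ℝ => g x * cexp (I * (((u₀ + j * s : ℝ) : ℂ) + I * δ) * x)) =
        fun x : ℝ => cexp (2 * π * I * j * (x : ℂ) / (T : ℂ)) * Gm x := by
      funext x
      rw [soloBlind_exp_split_plus u₀ s δ x j hs.ne', ← hTdef, hGm_def]
      ring
    rw [hfun, hcoef hGm_int (fun x hx => by simp [hGm_def, hx]) j]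
  -- polarised Parseval for `(Gm2, Gp2)` on the circle of length `T`
  have key := soloBlind_hasSum_conj_fourierCoeffOn_mul hT hGm2 hGp2
  have key2 : HasSum (fun j : ℤ => conj (fourierCoeffOn (lt_add_of_pos_right c hT) Gm2 (-j)) *
      fourierCoeffOn (lt_add_of_pos_right c hT) Gp2 (-j))
      (T⁻¹ • ∫ x in c..c + T, conj (Gm2 x) * Gp2 x) :=
    (Equiv.neg ℤ).hasSum_iff.mpr key
  have key3 := key2.mul_left ((T : ℂ) ^ 2)
  -- pointwise value of `conj Gm2 · Gp2`
  have hpt : ∀ x, conj (Gm2 x) * Gp2 x =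
      (conj (g x) * g x + conj (g (x + T)) * g (x + T)) +
      (((Real.exp (δ * T) : ℝ) : ℂ) * cexp (((u₀ * T : ℝ) : ℂ) * I) * (conj (g x) * g (x + T)) +
        ((Real.exp (-(δ * T)) : ℝ) : ℂ) * cexp (-(((u₀ * T : ℝ) : ℂ) * I)) *
          (conj (g (x + T)) * g x)) := by
    intro x
    have h4t : conj (Gm2 x) * Gp2 x = conj (Gm x) * Gp x + conj (Gm (x + T)) * Gp (x + T) +
        (conj (Gm x) * Gp (x + T) + conj (Gm (x + T)) * Gp x) := by
      simp only [hGm2_def, hGp2_def, map_add]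
      ring
    rw [h4t]
    simp only [hGm_def, hGp_def, soloBlind_conj_weighted_mul_same, soloBlind_conj_weighted_mul_shift,
      soloBlind_conj_weighted_mul_unshift]
  -- integrability of the four pieces
  have hgc : MemLp (fun x => conj (g x)) 2 volume :=
    hg.of_le_mul (c := 1) (Complex.continuous_conj.comp_aestronglyMeasurable hg.aestronglyMeasurable)
      (Filter.Eventually.of_forall fun x => by simp)
  have hgT : MemLp (fun x => g (x + T)) 2 volume :=
    hg.comp_measurePreserving (measurePreserving_add_right volume T)
  have hgTc : MemLp (fun x => conj (g (x + T))) 2 volume :=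
    hgc.comp_measurePreserving (measurePreserving_add_right volume T)
  have hS1 : Integrable (fun x => conj (g x) * g x) volume :=
    MemLp.integrable_mul (p := 2) (q := 2) hgc hg
  have hS2 : Integrable (fun x => conj (g (x + T)) * g (x + T)) volume := hS1.comp_add_right T
  have hF : Integrable (fun x => conj (g x) * g (x + T)) volume :=
    MemLp.integrable_mul (p := 2) (q := 2) hgc hgT
  have hF' : Integrable (fun x => conj (g (x + T)) * g x) volume :=
    MemLp.integrable_mul (p := 2) (q := 2) hgTc hg
  -- the norm part: the two sheets together carry `‖g‖₂²`
  have hS12 : (∫ x in c..c + T, conj (g x) * g x) + (∫ x in c..c + T, conj (g (x + T)) * g (x + T)) =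
      (((∫ x : ℝ, ‖g x‖ ^ 2 : ℝ)) : ℂ) := by
    have hshift : (∫ x in c..c + T, conj (g (x + T)) * g (x + T)) =
        ∫ x in c + T..c + T + T, conj (g x) * g x :=
      intervalIntegral.integral_comp_add_right (fun x : ℝ => conj (g x) * g x) T
    rw [hshift, intervalIntegral.integral_add_adjacent_intervals hS1.intervalIntegrable
        hS1.intervalIntegrable,
      ← soloBlind_integral_eq_intervalIntegral_of_support hc2T hsupp (F := fun x => conj (g x) * g x)
        (fun x hx => by simp [hx])]
    have h3 : ∀ x, conj (g x) * g x = ((‖g x‖ ^ 2 : ℝ) : ℂ) := fun x => by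
      rw [Complex.conj_mul']; push_cast; ring
    simp_rw [h3]
    exact integral_ofReal
  -- the correlation part: `κ` and `conj κ`
  have hsuppF : Function.support (fun x => conj (g x) * g (x + T)) ⊆ Ioc c (c + T) := by
    intro x hx
    have h1 : g x ≠ 0 := fun h => hx (by simp [h])
    have h2 : g (x + T) ≠ 0 := fun h => hx (by simp [h])
    exact ⟨(hsupp h1).1, by have := (hsupp h2).2; linarith⟩
  have hFint : (∫ x in c..c + T, conj (g x) * g (x + T)) = ∫ x : ℝ, conj (g x) * g (x + T) :=
    (soloBlind_integral_eq_intervalIntegral_of_support hcT hsuppF (F := fun x => conj (g x) * g (x + T))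
      (fun x hx => hx)).symm
  have hF'int : (∫ x in c..c + T, conj (g (x + T)) * g x) = conj (∫ x : ℝ, conj (g x) * g (x + T)) := by
    rw [← soloBlind_integral_eq_intervalIntegral_of_support hcT hsuppF (F := fun x => conj (g (x + T)) * g x)
        (fun x hx => by
          rcases mul_eq_zero.mp hx with h | h
          · rw [map_eq_zero] at h
            simp [h]
          · simp [h]),
      ← integral_conj]
    congr 1
    funext x
    simp [mul_comm]
  -- the value of the Parseval integral
  have hval : (T⁻¹ • ∫ x in c..c + T, conj (Gm2 x) * Gp2 x) =
      ((T⁻¹ : ℝ) : ℂ) * ((((∫ x : ℝ, ‖g x‖ ^ 2 : ℝ)) : ℂ) +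
        ((Real.exp (δ * T) : ℝ) : ℂ) * cexp (((u₀ * T : ℝ) : ℂ) * I) *
          (∫ x : ℝ, conj (g x) * g (x + T)) +
        ((Real.exp (-(δ * T)) : ℝ) : ℂ) * cexp (-(((u₀ * T : ℝ) : ℂ) * I)) *
          conj (∫ x : ℝ, conj (g x) * g (x + T))) := by
    rw [Complex.real_smul]
    congr 1
    simp_rw [hpt]
    have hI12 : IntervalIntegrable (fun x => conj (g x) * g x + conj (g (x + T)) * g (x + T))
        volume c (c + T) := (hS1.add hS2).intervalIntegrable
    have hI3 : IntervalIntegrable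
        (fun x => ((Real.exp (δ * T) : ℝ) : ℂ) * cexp (((u₀ * T : ℝ) : ℂ) * I) * (conj (g x) * g (x + T)))
        volume c (c + T) :=
      (hF.const_mul (((Real.exp (δ * T) : ℝ) : ℂ) * cexp (((u₀ * T : ℝ) : ℂ) * I))).intervalIntegrable
    have hI4 : IntervalIntegrable
        (fun x => ((Real.exp (-(δ * T)) : ℝ) : ℂ) * cexp (-(((u₀ * T : ℝ) : ℂ) * I)) *
          (conj (g (x + T)) * g x)) volume c (c + T) :=
      (hF'.const_mul (((Real.exp (-(δ * T)) : ℝ) : ℂ) * cexp (-(((u₀ * T : ℝ) : ℂ) * I)))).intervalIntegrable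
    have hI34 : IntervalIntegrable
        (fun x => ((Real.exp (δ * T) : ℝ) : ℂ) * cexp (((u₀ * T : ℝ) : ℂ) * I) * (conj (g x) * g (x + T)) +
          ((Real.exp (-(δ * T)) : ℝ) : ℂ) * cexp (-(((u₀ * T : ℝ) : ℂ) * I)) *
          (conj (g (x + T)) * g x)) volume c (c + T) := hI3.add hI4
    rw [intervalIntegral.integral_add hI12 hI34,
      intervalIntegral.integral_add hS1.intervalIntegrable hS2.intervalIntegrable,
      intervalIntegral.integral_add hI3 hI4,
      intervalIntegral.integral_const_mul, intervalIntegral.integral_const_mul, hS12, hFint, hF'int]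
    ring
  -- assemble
  have hT' : (T : ℂ) ≠ 0 := by exact_mod_cast hT.ne'
  have hfun_eq : (fun j : ℤ =>
        (∫ x : ℝ, g x * cexp (I * (((u₀ + j * s : ℝ) : ℂ) - I * δ) * x)) *
        conj (∫ x : ℝ, g x * cexp (I * (((u₀ + j * s : ℝ) : ℂ) + I * δ) * x))) =
      fun j : ℤ => (T : ℂ) ^ 2 * (conj (fourierCoeffOn (lt_add_of_pos_right c hT) Gm2 (-j)) *
        fourierCoeffOn (lt_add_of_pos_right c hT) Gp2 (-j)) := by
    funext j
    rw [hA j, hB j]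
    simp only [map_mul, Complex.conj_ofReal]
    ring
  have hval_eq : ((T : ℝ) : ℂ) * ((((∫ x : ℝ, ‖g x‖ ^ 2 : ℝ)) : ℂ) +
        ((Real.exp (δ * T) : ℝ) : ℂ) * cexp (((u₀ * T : ℝ) : ℂ) * I) *
          (∫ x : ℝ, conj (g x) * g (x + T)) +
        ((Real.exp (-(δ * T)) : ℝ) : ℂ) * cexp (-(((u₀ * T : ℝ) : ℂ) * I)) *
          conj (∫ x : ℝ, conj (g x) * g (x + T))) =
      (T : ℂ) ^ 2 * (T⁻¹ • ∫ x in c..c + T, conj (Gm2 x) * Gp2 x) := by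
    rw [hval]
    push_cast
    field_simp
  rw [hfun_eq, hval_eq]
  exact key3

end Summit.RiemannHypothesis.RiemannHypothesis.Theorems
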